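import Summits.QuantumFields.YangMills.Theorems.BalabanUVNodesK0Stub2PrimeJunction
import Summits.QuantumFields.YangMills.Theorems.BalabanUVNodesK0PrintCubeOfStepTokensR
import Literature.MathematicalPhysics.QuantumFieldTheory.Balaban1983to89.B8Prop6CubeMemberScalarGammaOfIneq159Printed
import Literature.MathematicalPhysics.QuantumFieldTheory.Balaban1983to89.B8Ineq159FlatCubeMemberTransplant

/-!
# K0⁷ STUB 2′ — THE SENTENCE HOLDS: [6] Proposition 6 at NODE 00's print-faithful cubes `zdCubP (MatA 2) F.L ρ₀` for EVERY family `F`, from dag-n05-c's PROVED flat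
# fact `Ineq159FlatCubeMemberPrinted` (T4) through dag-n05-e's flat line γ (Fγ10b) and this seat's junction (p590333)

Cell `pub-ymgap`, width seat `pub-ymgap-k0-s2-w1` (g0; director-ym №197 ∕ HUMAN RULING D-0149).  `--kind proof --supports stmt-QuantumFields-20541 --as helper`.
[6] = [Balaban1985RegularSpaces]; [4] = [Balaban1985BackgroundPropagators]; [B6] = [Balaban1984PropagatorsII]; [15] = [Balaban1985Variational]; [I] = [Balaban1987RG1].

CONTEXT.  Plan g79's stub-2 repair of record (R-b) re-cuts V18's stub 2 (Prop. 6 at EVERY `Node00.CubeB8` cube, thin collars `ρ = L` included — beyond print's p. 98 class;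
k0-s2-w2 LOCATED-CARRIER, evidence #22) to STUB 2′ := `∀ F, ∃ ρ₀ B₁ c₁, 1 ≤ ρ₀ ∧ 0 ≤ B₁ ∧ 0 < c₁ ∧ B8.Prop6Printed 4 (F.L : ℝ) B₁ c₁ (fun i : ZdIdx 4 F.L => zdCubP (MatA 2) F.L ρ₀ i)`
(print's cube class `CubeB8.IsPrint ρ₀` at SOME big-block size `ρ₀`; (b1) k0-s2-w2 `Node00.CarriersB8CubePrint`, (b2) dag-n07-e `Node00.TorusCoverGaugeTokensRPrint`, (b3) dag-n21-c
`K0PrintCubeOfStepTokensR` — all in tree; the plan's V19 registration pending, V18 STANDS).  Three tree theorems now compose to that sentence: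
* dag-n05-c g12 (T4) `B8Ineq159FlatCubeMemberTransplant.ineq159FlatCubeMemberPrinted_holds (d ℓ) (4 ≤ ℓ) (Odd (ℓ+1)) : Ineq159FlatCubeMemberPrinted (d+1) (ℓ+1)` — the ONE named
  flat fact of the flat line ((1.59) of [6] at `U₀ = 1` on the cube member over print's class = [4] Thm 3.3 at `U = 1`, Dirichlet exterior) PROVED on the torus chart;
* dag-n05-e g10 (Fγ10b) `B8Prop6CubeMemberScalarGammaOfIneq159Printed.gaugedBoundB8_cubeMember_scalar_γ_of_ineq159Printed (2 ≤ d) (2 ≤ L) (5 ≤ d·L) (h159) : ∃ B₀ c₁ ρ₀ M₀ N₀ R₀,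
  1 ≤ B₀ ∧ 0 < c₁ ∧ ∀ η > 0, ∀ c : CubeB8 d L K Ω` above print's p. 98 thresholds (`M_h = Lˢ ≥ 3`, `M₀ ≤ L^{s+1}`, `L^{s+1} ∣ ρ, M`, `R·L^{s+1} ≤ ρ`, `2L ≤ R`, `R₀ ≤ R`,
  `N₀+1 ≤ R·L^{s+1}`, `ρ₀ ≤ ρ`), `∀ U₀ ∈ 𝔄_K({Ω_j}, α₀)` with `7dL²Mα₀ ≤ c₁`: `GaugedBoundB8 L η U₀ c (7dL²·(5dLB₀)·Mα₀)` — Proposition 6's conclusion PER CUBE;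
* this seat's (p590333) `K0Stub2PrimeJunction.prop6MemberB8AtP_of_perCubeLetterPow` — the per-cube letter of exactly that shape at `𝔸 = M₂(ℂ)`, `d = 4` ⟹ stub 2′'s body at `F`
  (big-block size `ρ₀` CHOSEN from the thresholds by `exists_powBlock_of_thresholds`; `prop6Printed_zdCubP_iff`).

WHAT THIS FILE PROVES (theorems only; 0 `def`; no new named fact; nothing modified).
§1 `ineq159FlatCubeMemberPrinted_four (F)` — the named flat fact AT THE K0 LETTERS `(d, L) = (4, F.L)`: T4 at `d := 3`, `ℓ := F.L − 1` (`F.hL.1 : Odd L`, `F.hL11 : 11 < L`).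
§2 `prop6MemberB8AtP_of_ineq159Printed (F) (h159 : Ineq159FlatCubeMemberPrinted 4 F.L)` — stub 2′'s body at `F` MODULO the named fact: Fγ10b at `𝔸 := MatA 2`, `d := 4`
   (`2 ≤ 4`, `2 ≤ F.L`, `5 ≤ 4·F.L`) into the junction with `B₁ := 5·4·L·B₀` (print's «B₁ = 5dLB₀», Prop. 3 p. 87).
§3 ★★★ `prop6MemberB8AtP_holds (F)` ∕ `prop6MemberB8AtP_holds_all` — STUB 2′'s SENTENCE, hypothesis-free: `∀ F : T4Family, ∃ ρ₀ : ℕ, ∃ B₁ c₁ : ℝ, 1 ≤ ρ₀ ∧ 0 ≤ B₁ ∧ 0 < c₁ ∧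
   B8.Prop6Printed 4 (F.L : ℝ) B₁ c₁ (fun i : ZdIdx 4 F.L => zdCubP (MatA 2) F.L ρ₀ i)` — §2 ∘ §1.  This is the `h2P` binder of dag-n21-c's (b3) PART 2
   `K0PrintCubeOfStepTokensR.record13SepCoPHBody_of_stubs1_2P_3A'` VERBATIM (and the body of plan g81's REGISTERED V19 stub `stub_prop6MemberB8AtP13 : ∀ F : T4Family, Prop6MemberB8AtP F`
   (`[YMPLAN-G81-K0V19-REGISTERED 87879403b3a26109]`, `HOME/pub-ymgap-plan/D81-K0V19/`) by BODY — the skeleton's predicate is not in the tree yet: no stub is closed BY NAME here).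
§4 ★ `record13SepCoPHBody_of_stub1_stub3A'` — K0⁷'s BODY ON EVERY FAMILY FROM STUB 1 AND 3ᴬ′ ALONE: (b3) PART 2 with its `h2P` slot FILLED by §3.  The two remaining binders are
   V18∕V19 stub 1 VERBATIM ([15] Prop. 8's top step at the record's support selector, N07) and 3ᴬ′ (PART 1's sign-free β-box of A1's witness, NODE O) — DISPLAYED, OPEN.

HONEST SCOPE ∕ A6 (director-ym №189 (3); referee protocol A1–A6).  (A1) ₁₃SepCoPH-keyed ⇒ K0⁷ stmt-QuantumFields-20541 stays OPEN: the route decl `Record13SepCoPHInhabited` is NOT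
concluded by name; §4 is CONDITIONAL on stubs 1 and 3ᴬ′ (not inhabited here).  V19's registered stub `stub_prop6MemberB8AtP13 : ∀ F : T4Family, Prop6MemberB8AtP F`
has §3 as its body; the BY-NAME filing follows in a separate file once the predicate's tree mirror `K0V19Defs.Prop6MemberB8AtP` (review lane) lands — no stub credit is
claimed by THIS file.  (A2) §3 IS an inhabitation of stub 2′'s sentence (standard axioms, no hypothesis) — of the SENTENCE AS
TYPED: [6] Prop. 6's conclusion in NODE 00's letters `GaugedBoundB8` at print's p. 98 cube class above thresholds, for the small-field class `InAk` and `7dL²Mα₀ ≤ c₁`; whether those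
letters carry print's full analytic content is exactly what the referees' LOCATED notes on the carriers record (k0-s2-w2 #22 LOCATED-CARRIER for V18's wider class — 2′ ≤ print;
dag-n05-a LOCATED-AVG135 concerns the `zdGF3` road, NOT used here).  V18's stub 2 (ALL `CubeB8` cubes) is NOT discharged by this file and is not claimed.  (A3) no restatement: §3's
type is (b3)'s `h2P` binder and the junction's conclusion byte-for-byte.  (A4) constants: `B₁ = 5·4·L·B₀`, `c₁`, `ρ₀` are Fγ10b's ∕ the junction's witnesses, not chosen here.
(A6) nothing STRONGER than print is asserted: every analytic step is a tree theorem BY NAME (T4, Fγ10b, (b1)–(b3)); this file is composition + `omega`-grade arithmetic on `F.L`.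
Counts unmoved (typed 28∕28 · discharged 5∕27) — count words belong to the chair ∕ director.  One finite 𝕋⁴ programme at fixed `ε = L^{−K}`, Bałaban AS PRINTED — NOT continuum ∕
ℝ⁴ ∕ OS ∕ mass gap ∕ Clay: the Yang–Mills mass gap is NOT proved by any of this; route R4 closes the CONDITIONAL finite-𝕋⁴ rung `BalabanLadder.UV` only.
No `sorry`, `def`, `instance`, `notation`; standard axioms.
-/

noncomputable section

open scoped Matrix.Norms.L2Operator

namespace Summit.QuantumFields.YangMills.Theorems.K0Stub2PrimeHolds

open Literature.MathematicalPhysics.QuantumFieldTheory.Balaban1983to89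
open Literature.MathematicalPhysics.QuantumFieldTheory.Balaban1983to89.Node00
open Literature.MathematicalPhysics.QuantumFieldTheory.Balaban1983to89.T4Continuum
open Literature.MathematicalPhysics.QuantumFieldTheory.Balaban1983to89.FlowStep
open Literature.MathematicalPhysics.QuantumFieldTheory.Balaban1983to89.B8LeafModelZd (ZdIdx)
open Literature.MathematicalPhysics.QuantumFieldTheory.Balaban1983to89.B8Ineq159FlatCubeMemberPrinted (Ineq159FlatCubeMemberPrinted)
open Literature.MathematicalPhysics.QuantumFieldTheory.Balaban1983to89.B8Ineq159FlatCubeMemberTransplant (ineq159FlatCubeMemberPrinted_holds)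
open Literature.MathematicalPhysics.QuantumFieldTheory.Balaban1983to89.B8Prop6CubeMemberScalarGammaOfIneq159Printed (gaugedBoundB8_cubeMember_scalar_γ_of_ineq159Printed)
open Summit.QuantumFields.YangMills.Theorems.K0Stub2PrimeJunction (prop6MemberB8AtP_of_perCubeLetterPow)
open Summit.QuantumFields.YangMills.Theorems.K0PrintCubeOfStepTokensR (record13SepCoPHBody_of_stubs1_2P_3A')

/-! ## §1 The named flat fact at the K0 letters `(d, L) = (4, F.L)` -/

/-- **THE FLAT FACT (1.59)∕[4] Thm 3.3 AT `U = 1` ON THE CUBE MEMBER, AT `d = 4`, `L = F.L`** — dag-n05-c's T4 `ineq159FlatCubeMemberPrinted_holds` (all `d + 1`, odd `ℓ + 1 ≥ 5`)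
at `d := 3`, `ℓ := F.L − 1` (`F.L` odd, `F.L > 11`). [cite: Balaban1985RegularSpaces, (1.59) p.86, p.98; Balaban1985BackgroundPropagators, Thm 3.3 p.399] -/
theorem ineq159FlatCubeMemberPrinted_four (F : T4Family) : Ineq159FlatCubeMemberPrinted 4 F.L := by
  have h11 := F.hL11
  have hodd : Odd (F.L - 1 + 1) := by rw [Nat.sub_add_cancel (by omega)]; exact F.hL.1
  have h := ineq159FlatCubeMemberPrinted_holds 3 (F.L - 1) (by omega) hodd
  rwa [Nat.sub_add_cancel (by omega)] at h

/-! ## §2 Stub 2′'s body at `F` modulo the named fact -/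

/-- **STUB 2′'s BODY AT `F` FROM THE NAMED FLAT FACT AT `(4, F.L)`**: dag-n05-e's Fγ10b (Proposition 6's conclusion `GaugedBoundB8` per cube above print's p. 98 thresholds,
constant `7dL²·(5dLB₀)·Mα₀`) at `𝔸 := M₂(ℂ)`, `d := 4`, fed to this seat's junction `prop6MemberB8AtP_of_perCubeLetterPow` with `B₁ := 5·4·L·B₀` (the big-block size is chosen
there from the thresholds).  CONDITIONAL on `h159` only. [cite: Balaban1985RegularSpaces, Prop. 6 (1.135)–(1.138) p.99, p.98, Thm 4 p.88, Prop. 3 p.87 («B₁ = 5dLB₀»), (1.59) p.86] -/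
theorem prop6MemberB8AtP_of_ineq159Printed (F : T4Family) (h159 : Ineq159FlatCubeMemberPrinted 4 F.L) :
    ∃ ρ₀ : ℕ, ∃ B₁ c₁ : ℝ, 1 ≤ ρ₀ ∧ 0 ≤ B₁ ∧ 0 < c₁ ∧
      (letI : CStarAlgebra (MatA 2) := {}; B8.Prop6Printed 4 (F.L : ℝ) B₁ c₁ (fun i : ZdIdx 4 F.L => zdCubP (MatA 2) F.L ρ₀ i)) := by
  letI : CStarAlgebra (MatA 2) := {}
  have h11 := F.hL11
  have hL2 : 2 ≤ F.L := by omega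
  have hdL : 5 ≤ 4 * F.L := by omega
  obtain ⟨B₀, c₁, ρ₀', M₀, N₀, R₀, hB₀, hc₁, G⟩ :=
    gaugedBoundB8_cubeMember_scalar_γ_of_ineq159Printed (𝔸 := MatA 2) (d := 4) (by norm_num) hL2 hdL h159
  have hB₀' : 0 ≤ B₀ := le_trans zero_le_one hB₀
  have hB₁ : 0 ≤ 5 * ((4 : ℕ) : ℝ) * (F.L : ℝ) * B₀ := by positivity
  exact prop6MemberB8AtP_of_perCubeLetterPow F hB₁ ⟨c₁, ρ₀', M₀, N₀, R₀, hc₁, G⟩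

/-! ## §3 ★★★ Stub 2′'s sentence holds -/

/-- **★★★ STUB 2′'s SENTENCE AT `F`, HYPOTHESIS-FREE**: [6] Proposition 6 ((1.135)–(1.138), conclusion `GaugedBoundB8`, constant `7·4·L²·B₁·M·α₀`) at EVERY print-faithful cube
`zdCubP (MatA 2) F.L ρ₀` of NODE 00's family for SOME big-block size `ρ₀ ≥ 1` and constants `B₁ ≥ 0`, `c₁ > 0` — §2 at §1.  The `h2P F` binder of (b3) PART 2 VERBATIM; V19's drafted
`Prop6MemberB8AtP F` by BODY (V19 not registered; nothing closed by name).  V18's stub 2 (all `CubeB8` cubes) is NOT claimed. [cite: Balaban1985RegularSpaces, Prop. 6 (1.135)–(1.138) p.99, p.98, Thm 4 p.88, Prop. 3 p.87, (1.59) p.86; Balaban1985BackgroundPropagators, Thm 3.3 p.399] -/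
theorem prop6MemberB8AtP_holds (F : T4Family) :
    ∃ ρ₀ : ℕ, ∃ B₁ c₁ : ℝ, 1 ≤ ρ₀ ∧ 0 ≤ B₁ ∧ 0 < c₁ ∧
      (letI : CStarAlgebra (MatA 2) := {}; B8.Prop6Printed 4 (F.L : ℝ) B₁ c₁ (fun i : ZdIdx 4 F.L => zdCubP (MatA 2) F.L ρ₀ i)) :=
  prop6MemberB8AtP_of_ineq159Printed F (ineq159FlatCubeMemberPrinted_four F)

/-- **STUB 2′'s SENTENCE, QUANTIFIED OVER FAMILIES** — the `∀ F` form (= (b3) PART 2's hypothesis `h2P`; = the drafted V19 stub's type by body). [cite: Balaban1985RegularSpaces, Prop. 6 p.99, p.98] -/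
theorem prop6MemberB8AtP_holds_all :
    ∀ F : T4Family, ∃ ρ₀ : ℕ, ∃ B₁ c₁ : ℝ, 1 ≤ ρ₀ ∧ 0 ≤ B₁ ∧ 0 < c₁ ∧
      (letI : CStarAlgebra (MatA 2) := {}; B8.Prop6Printed 4 (F.L : ℝ) B₁ c₁ (fun i : ZdIdx 4 F.L => zdCubP (MatA 2) F.L ρ₀ i)) :=
  prop6MemberB8AtP_holds

/-! ## §4 ★ K0⁷'s body on every family from stub 1 and 3ᴬ′ alone -/

/-- **★ K0⁷'s BODY AT EVERY FAMILY FROM STUB 1 AND 3ᴬ′** — dag-n21-c's (b3) PART 2 `record13SepCoPHBody_of_stubs1_2P_3A'` with its stub-2′ slot `h2P` FILLED by §3: the remaining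
binders are `h1` = V18 stub 1 VERBATIM ([15] Prop. 8's top step at the record's support selector for SOME guarded `(B₃, a₀, a₁)`) and `h3A'` = 3ᴬ′ (PART 1's sign-free β-box of A1's
witness at every cube letter `(j, c)` with `c ≤ L^j`).  CONDITIONAL on those two (DISPLAYED, not inhabited here); K0⁷ NOT closed; the route decl is not concluded by name.
[cite: Balaban1985Variational, Thm 1 (8)–(9) p.279, (144)–(152) pp.300–301, Prop. 8 p.304; Balaban1985RegularSpaces, Prop. 6 p.99, p.98; Balaban1988Convergent, Thm 1 p.262, (2.6)–(2.8) pp.255–256; Balaban1987RG1, Thm 1 p.259, §1 p.264] -/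
theorem record13SepCoPHBody_of_stub1_stub3A'
    (h1 : ∀ F : T4Family, ∃ B₃ a₀ a₁ : ℝ, 2 * (F.L : ℝ) ^ 2 ≤ B₃ ∧ 0 < a₀ ∧ 0 < a₁ ∧
      Prop8RegSepTopStep F 2 (fun ν K Ω => suppDomOfRecord F ν K Ω) B₃ a₀ a₁)
    (h3A' : ∀ (F : T4Family) (j c : ℕ) (B₃ B₃' a₀ a₁ : ℝ), c ≤ F.L ^ j → 2 * (F.L : ℝ) ^ 2 ≤ B₃ → 0 < B₃' → 0 < a₀ → 0 < a₁ →
      VariationalThm1RegSepCoP7M F 2 B₃ a₀ a₁ →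
      Gauge9RegSepTopStepR F 2 (fun ν K Ω => suppDomOfRecord F ν K Ω) (F.L ^ j) c B₃ B₃' a₀ a₁ →
      ∃ γ₀ ε₀ ε₂₉ β' : ℝ, 0 < γ₀ ∧ 0 < ε₀ ∧ 0 < ε₂₉ ∧
        BetaLowerH (-β') γ₀ (betaOfRecord₁₃ F 2 (theta13OfThm1CCM F 2 j ε₀ ε₂₉ B₃ B₃' a₀ a₁)) ∧
        BetaUpperH β' γ₀ (betaOfRecord₁₃ F 2 (theta13OfThm1CCM F 2 j ε₀ ε₂₉ B₃ B₃' a₀ a₁))) :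
    ∀ F : T4Family, ∃ θ : Stage13HParams F 2, θ.Provisos₁₃SepCoPH F 2 ∧ (θ.ZhUnity F 2 ∧ θ.SlotsNondegenerate₁₃ F 2) ∧ θ.Admissible F 2 :=
  record13SepCoPHBody_of_stubs1_2P_3A' h1 prop6MemberB8AtP_holds h3A'

end Summit.QuantumFields.YangMills.Theorems.K0Stub2PrimeHolds

end
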